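import Summits.QuantumFields.YangMills.Theorems.SwapVirialDeficitNearFlatLeaders
import HarnessLib

/-!
# THE HUB COMMUTATOR FROM THE σ-RELATIONS: `‖[c, C₀]‖ ≤ (‖cC₁ − C₀c‖ + ‖cC₀ − C₁c‖)/(2|re c|)` — why the A-projection is Lipschitz away from the END hub
# (free-hands support of ⟨stmt-QuantumFields-24197⟩ `SwapVirialDeficit.SwapGluedStiffness`; near-flat projection of LEAD g98's plan of record memo7 §C(c): the commutator of the hub
# with `C₀` is NOT a relation (stratum B has `c ⊥ C₀`), but `[c², C₀]` is, and `[c², X] = 2·re(c)·[c, X]`)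

* `comm_sq_eq_smul` (`c²X − Xc² = (2 re c)·(cX − Xc)`), `norm_comm_sq_le_sigma` (`‖c²C₀ − C₀c²‖ ≤ ‖cC₁ − C₀c‖ + ‖cC₀ − C₁c‖` for unit `c`),
* ★ `norm_comm_hub_le` (`2|re c|·‖cC₀ − C₀c‖ ≤ ‖cC₁ − C₀c‖ + ‖cC₀ − C₁c‖`): together with ✓`chartBox_of_chartDeficit` (σ-residuals `≤ 60L³√F`) the heavy-hub projection
  ✓`exists_flatQuat_near` (h = 3) is Lipschitz with constant `≲ L³/(‖im c‖·|re c|)` — off the apex AND off the end, as in the sketch (STATUS 19:34Z (ii)/(iv)).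

HONEST LABEL: elementary quaternion algebra; stubs of ➎, ⟨24197⟩ ∕ ⟨24194⟩ ∕ ⟨24497⟩ OPEN; own crux ⟨22884⟩ OPEN (blocked-on ⟨19935⟩); the Yang–Mills mass gap is NOT proved; no
summit is proved by a line.  THEOREMS ONLY (0 `def`, 0 `sorry`), standard axioms.  Width seat ym-line-sfw-p2-w3 g66 (cell ym-idea-1, free hands), `--supports stmt-QuantumFields-24197`.
References: [folklore].
-/

set_option autoImplicit false

noncomputable section

open Quaternion
open scoped Quaternion

namespace Summit.QuantumFields.YangMills.Theorems.SwapVirialDeficit.NearFlat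

/-- `c²X − Xc² = (2 re c)·(cX − Xc)`: the real part commutes, `im(c²) = 2 re(c) im(c)`. [folklore] -/
theorem comm_sq_eq_smul (c X : ℍ) : c ^ 2 * X - X * c ^ 2 = (2 * c.re) • (c * X - X * c) := by
  have hc : c = (c.re : ℍ) + c.im := (Quaternion.re_add_im c).symm
  have him : c.im * c.im = -((Quaternion.normSq c.im : ℝ) : ℍ) := by
    have h := Quaternion.self_mul_star c.im
    rw [Quaternion.star_im, mul_neg] at h
    rw [← h, neg_neg]
  rw [sq, hc]
  simp only [add_mul, mul_add, him]
  ext <;> simp <;> ring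

/-- For a unit `c`: `‖c²C₀ − C₀c²‖ ≤ ‖cC₁ − C₀c‖ + ‖cC₀ − C₁c‖`. [folklore] -/
theorem norm_comm_sq_le_sigma {c : ℍ} (hc : ‖c‖ = 1) (C₀ C₁ : ℍ) : ‖c ^ 2 * C₀ - C₀ * c ^ 2‖ ≤ ‖c * C₁ - C₀ * c‖ + ‖c * C₀ - C₁ * c‖ := by
  have e : c ^ 2 * C₀ - C₀ * c ^ 2 = c * (c * C₀ - C₁ * c) + (c * C₁ - C₀ * c) * c := by rw [sq]; noncomm_ring
  rw [e]
  calc ‖c * (c * C₀ - C₁ * c) + (c * C₁ - C₀ * c) * c‖ ≤ ‖c * (c * C₀ - C₁ * c)‖ + ‖(c * C₁ - C₀ * c) * c‖ := norm_add_le _ _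
    _ = ‖c * C₀ - C₁ * c‖ + ‖c * C₁ - C₀ * c‖ := by rw [norm_mul, norm_mul, hc, one_mul, mul_one]
    _ = _ := add_comm _ _

/-- ★ **The hub commutator from the σ-relations**: `2|re c|·‖cC₀ − C₀c‖ ≤ ‖cC₁ − C₀c‖ + ‖cC₀ − C₁c‖` (unit `c`). [folklore] -/
theorem norm_comm_hub_le {c : ℍ} (hc : ‖c‖ = 1) (C₀ C₁ : ℍ) : 2 * |c.re| * ‖c * C₀ - C₀ * c‖ ≤ ‖c * C₁ - C₀ * c‖ + ‖c * C₀ - C₁ * c‖ := by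
  have h := norm_comm_sq_le_sigma hc C₀ C₁
  rw [comm_sq_eq_smul, norm_smul, Real.norm_eq_abs, abs_mul, abs_two] at h
  exact h

end Summit.QuantumFields.YangMills.Theorems.SwapVirialDeficit.NearFlat

end
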